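/-
Copyright (c) 2026 the pub-hodgecm-mathlib formalisation cell (harness21).  Typer seat hodgecm-mathlib-typ-T5a (g0), topic T5 = P8
«(C♯)hol interior», 2026-08-31.  Statement-only Literature module: ONE named fact, no proof.
-/
import Literature.NumberTheory.Automorphic.Liu2021.ThetaLiftFromLineMeets
import Literature.NumberTheory.Automorphic.Liu2021.Def412AdmissibleIffParity
import HarnessLib

/-!
# [Liu2021, App. D Lem. D.2 (1)–(2) (le:weil_arch) applied in the proof of Prop. 4.13, Case 1 (l. 2137–2141); Konno–Konno 2007 Thm. 5.4;
# Bergeron–Millson–Moeglin 2016 §5.7] — THE ARCHIMEDEAN WEIL DICTIONARY: a HOLOMORPHIC `H¹`-cohomological theta lift from the line `⟨a⟩` at the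
# `μ`-splitting has `μ` OF WEIGHT ONE and `a·δ′` `μ`-ADMISSIBLE (node C = D2 of the (C♯)hol interior)

Topic `NumberTheory/Automorphic/Liu2021`; namespace `Literature.NumberTheory.Automorphic.Liu2021`.  STATEMENT-ONLY: ONE closed named fact
`def meetsThetaLiftFromLine_hol_hasWeightOne_admissible : Prop` (no `sorry`, no instance, no notation); imports = tree (★ `ThetaLiftFromLineMeets`,
★ `Def412AdmissibleIffParity` for `IsAdmissibleElement` ∕ `HasWeight` ∕ `IsConjugateSymplectic.cmType`).  Cell hodgecm-mathlib FLOOR 0, programme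
P2, topic T5 = P8: the D2 HALF of the printed proof behind the booked letter (C♯)hol
`Literature.NumberTheory.Rogawski1990.cohFinComponent_isThetaSigned_hol` (★ p824128); its conclusion is (C♯)hol's SIGN CONJUNCTS verbatim
(`HasWeight L μ 1`, `IsAdmissibleElement L hμ.cmType.1 (a · (2·imagUnit L)⁻¹)`).  Frame = (C♯)hol's VERBATIM + letter A's adelic transport `ιA`.

PRINT.  [Liu2021, proof of Prop. 4.13 Case 1, FJcycle.tex l. 2137–2141; Camb. J. Math. 9 (2021) p. 48]: «To determine `π_∞`, we suppose that
`Φ_F = {τ₁ = τ, τ₂, …, τ_d}` and `Φ = {τ₁⁺, …, τ_d⁺}` with `π(τ_i⁺) = τ_i`.  Using `Φ`, we obtain an isomorphism `G_ℝ ≃ U(n−1,1)_ℝ × U(n,0)_ℝ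
× ⋯ × U(n,0)_ℝ`, and accordingly a decomposition `π_∞ = ⊗_{i=1}^d π_{∞i}`.  Under the notation from Subsection D.1, we have
`π_{∞1} ≃ ω_{n−1,1}^{m₁,±,1}` and `π_{∞i} ≃ ω_{n,0}^{m_i,±,1}` for `i ≥ 2`, where `(m₁, …, m_d)` is the weight of `μ` and the sign in the
parameter is the sign of `i⁻¹τ_i⁺(e)`.  By Lemma D.2, we know that `μ` is of weight one and `ε_e` is `μ`-admissible.  Moreover,
`H¹(𝔤, K_G; π_∞)` is of dimension `1`.»  [Liu2021, App. D §D.1 before Lem. D.2 (l. 5268–5277; p. 127)]: «Now we take `F = ℝ` and `E = ℂ`.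
Let `(p,q)` be the signature of `V` … In the construction of `ω(μ, ε, χ)`, the three parameters have the following possibilities:
`μ_m(z) = arg(z)^m`, `m` odd integer; `ε = ±i`; `χ_l(z) = z^l`, `l ∈ ℤ`.  … we denote by `ω_{p,q}^{m,±,l}` the representation
`ω(μ_m, ±i, χ_l)` of `U(p,q)_ℝ`.  It is well-known (see, for example, [SW78]*Section 4) that `ω_{p,q}^{m,±,l}` is irreducible.  By the
computation in [BMM]*Section 5, up to equivalence, there are only two irreducible unitary representations `π` of `U(n−1,1)_ℝ` such that
`H¹(𝔲_{n−1,1}, K_{n−1,1}; π) ≠ {0}`, in which case the cohomology has dimension `1` … `π^{1,0}_{n−1,1}` and `π^{0,1}_{n−1,1}` … Hodge types `(1,0)`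
and `(0,1)`.»  **Lemma D.2** (le:weil_arch, l. 5279–5289; p. 127): «(1) Among the representations `ω_{n,0}^{m,±,l}`, only `ω_{n,0}^{1,+,0}` and
`ω_{n,0}^{−1,−,0}` are the trivial character.  (2) If `n ≥ 3`, then in the set `{ω_{n−1,1}^{m,±,l}}`, only `ω_{n−1,1}^{−1,−,0}` (resp.
`ω_{n−1,1}^{1,+,0}`) is isomorphic to `π^{1,0}_{n−1,1}` (resp. `π^{0,1}_{n−1,1}`).»  Proof (l. 5291–5295): «The explicit formulae for the
`K_{p,q}`-type of `ω_{p,q}^{m,±,l}` can be found in, for example, [KK07]*Theorem 5.4 with `p′+q′ = 1` … Comparing the formula for the highest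
weights in [BMM]*5.7 with `p = n−1, q = 1, a+b = 1 (≤ p)` with [KK07]*Theorem 5.4, we obtain the assertions.»  Weight ∕ CM type ∕ admissibility:
[Liu2021, §4.1 l. 1908–1912 (p. 41–42)] «`μ_τ : z ↦ arg(z)^{−w_τ}` … via the unique element `τ′ ∈ Φ_μ` above `τ`», Def. 4.3, Def. 4.12 (p. 47)
«`τ′(e)` has negative imaginary part for every `τ′ ∈ Φ_μ`».

THE ASSEMBLY (printed proof, spelled out; `w_i` the place of `τ_i`).  At `i = 1` (the place of `ι`): `π_{∞1}` is `H¹`-cohomological of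
type `(1,0)` ⇒ (Lem. D.2 (2)) `(m₁, sign(i⁻¹τ₁⁺(e)), l₁) = (−1, −, 0)`; at `i ≥ 2`: the cotangent form is RIGHT-INVARIANT under the compact
factor `K_c ⊇ U(H)(L⁺_{w_i}) ≅ U(3,0)_ℝ` (★ `cmCompactFactor`), so `π_{∞i}` is trivial ⇒ (Lem. D.2 (1)) `(m_i, sign_i, l_i) ∈ {(1,+,0),
(−1,−,0)}`.  Hence `|m_i| = 1` for all `i` (WEIGHT ONE), and with `Φ_μ = {τ_i⁺ : m_i = −1} ∪ {τ̄_i⁺ : m_i = +1}` (`μ_{τ_i} = arg^{m_i}` through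
`τ_i⁺` is `arg^{−1}` through the member of `Φ_μ`): `Im τ′(e) < 0` for every `τ′ ∈ Φ_μ` (`m_i = −1`: sign `−` means `Im τ_i⁺(e) < 0`;
`m_i = +1`: sign `+` means `Im τ_i⁺(e) > 0`, i.e. `Im τ̄_i⁺(e) < 0`) — `ε_e` IS `μ`-ADMISSIBLE.  The implicit input «`π_∞` of the global
theta lift of the character `π_W` is the archimedean oscillator module `⊗_i ω(μ_{w_i}, e, χ_{w_i})`» is the archimedean case of the
localisation of a global theta lift [Rallis1984, proof of Thm. 1.2.2 p. 356] ∕ Howe duality for the compact member `U(W)(ℝ) = U(1)`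
[Howe1989, Thm. 1 and Remark (b) p. 536] (BMM's «global-to-local step», ★ `BergeronMillsonMoeglin2016.GlobalToLocal` at dictionary level).

TYPING (the tree's reading, nothing re-declared).  In (C♯)hol's frame, with letter A's adelic transport `ιA`: if `P` contains a non-zero
theta vector from `⟨a⟩` at the `μ`-splitting (★ `MeetsThetaLiftFromLine … P μ hμ a ιA`) and `P` is `H¹`-cohomological HOLOMORPHIC at `ι`
relative to `K_c` (★ `IsHolCotangentAt (cmArchSection …) (cmCompactFactor …)`), then `HasWeight L μ 1` (★, [Liu2021, Def. 4.3]) and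
`IsAdmissibleElement L hμ.cmType.1 (algebraMap L⁺ L a * (2 * imagUnit L)⁻¹)` (★ `Literature.AlgebraicGeometry.Liu2021.IsAdmissibleElement`,
[Liu2021, Def. 4.12]; `e = a·δ′`, `δ′ = (2·imagUnit L)⁻¹ ∈ L^{×−}`, the lane's discriminant of the line `⟨a⟩` — the SAME tokens as (C♯)hol's
conclusion, so the T5 head is an `∧`-introduction).  The conventions (which CM type `hμ.cmType` is, the sign of `δ′`, the tree's Weil
representation's `ε`) are exactly those already audited for (C♯)hol (F0P2-p02 (g5) AUDIT-CSharpHol-sign, 2026-08-31).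

HONEST SCOPE.  (i) The printed content is Lem. D.2 + three dictionary steps (cotangent `(1,0)` ↔ `π^{1,0}`; `K_c`-invariance ↔ `π_{∞i}`
trivial; global-to-local at `∞`); the per-place form of Lem. D.2 over the tree's archimedean Weil datum (★ `KonnoKonno2007.RealUnitaryDualPair`,
`IsArchWeilDatum`, `JunctionDegreeOneKTypes`) and (C♯)hol's output arithmetic are separable sub-nodes (T5 tree C∞ ∕ Cc ∕ C-asm), not split
here.  (ii) Junk models: without `IsHolCotangentAt` the conclusion fails (antiholomorphic `P`: `−e` is admissible instead; non-cohomological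
theta lifts: any odd weight); without `MeetsThetaLiftFromLine` at THIS `(μ, a)` the conclusion is about an unrelated pair.  (iii) No finite-adelic
conclusion (node B).  HC_CM is proved only modulo the printed citations until rung 0 closes; filing this file books ONE printed statement.

## References
* [Liu2021] Y. Liu, Camb. J. Math. 9 (2021) = arXiv:2102.11518: proof of Prop. 4.13 Case 1 (l. 2137–2141, p. 48); §4.1 (l. 1908–1921,
  pp. 41–42), Def. 4.3, Def. 4.12 (p. 47); App. D §D.1 (l. 5268–5295, p. 127), Lem. D.2.
* [KonnoKonno2007] T. Konno, K. Konno, Kyushu J. Math. 61 (2007), Thm. 5.4 (the `K`-types of the Fock model, `p′+q′ = 1`).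
* [BergeronMillsonMoeglin2016Balls] N. Bergeron, J. Millson, C. Moeglin, Acta Math. 216 (2016), §5, §5.7 (highest weights `V(bq, aq)`).
* [Rallis1984] S. Rallis, Compositio Math. 51 (1984), proof of Thm. 1.2.2 p. 356.  [Howe1989] R. Howe, J. AMS 2 (1989), Thm. 1, Rem. (b).
-/

noncomputable section

open NumberField NumberField.InfinitePlace MeasureTheory IsDedekindDomain
open scoped Matrix ComplexOrder

namespace Literature.NumberTheory.Automorphic.Liu2021

open _root_.MeasureTheory
open Literature.NumberTheory.Automorphic Literature.NumberTheory.Automorphic.UnitaryGroup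
open Literature.NumberTheory.Automorphic.UnitaryGroup.CotangentForms
open Literature.NumberTheory.Automorphic.IdeleClassGroup
open Literature.NumberTheory.GelbartRogawski1991.UnitaryDualPair
open Literature.AlgebraicGeometry.Liu2021 (IsAdmissibleElement)

/-- **Node C = D2 of the (C♯)hol interior [Liu2021, App. D Lem. D.2 (1)–(2) applied at Prop. 4.13 proof Case 1 (l. 2137–2141); KonnoKonno2007
Thm. 5.4; BergeronMillsonMoeglin2016 §5.7] — «By Lemma D.2, we know that `μ` is of weight one and `ε_e` is `μ`-admissible»**: in the frame
of (C♯)hol with letter A's adelic transport `ιA`, if the discrete `P` of `U(H)(𝔸_{L⁺})` contains a non-zero theta vector from the line `⟨a⟩` at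
the `μ`-attached splitting (★ `MeetsThetaLiftFromLine … P μ hμ a ιA`) and is `H¹`-cohomological of HOLOMORPHIC type at `ι` relative to the
compact factor (★ `IsHolCotangentAt`), then `μ` has weight one and `e = a·δ′` is `μ`-admissible for the CM type `Φ_μ = hμ.cmType`.
[cite: Liu2021, App. D Lem. D.2 (1)–(2) p. 127 (l. 5279–5289); Prop. 4.13 proof Case 1 (l. 2137–2141, p. 48); Def. 4.3; Def. 4.12 p. 47]
[cite: KonnoKonno2007, Thm. 5.4] [cite: BergeronMillsonMoeglin2016Balls, §5.7] [cite: Rallis1984, Thm. 1.2.2 proof p. 356] -/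
def meetsThetaLiftFromLine_hol_hasWeightOne_admissible : Prop :=
  ∀ (L : Type) [Field L] [NumberField L] [IsCMField L] (ι : L →+* ℂ) (H : Matrix (Fin 3) (Fin 3) L) (T : GL (Fin 3) ℂ)
    (hT : (T : Matrix (Fin 3) (Fin 3) ℂ)ᴴ * H.map ι * (T : Matrix (Fin 3) (Fin 3) ℂ) = Literature.Geometry.ComplexHyperbolic.BallModel.J),
    (∀ τ' : L →+* ℂ, InfinitePlace.mk τ' ≠ InfinitePlace.mk ι → (H.map τ').PosDef) → 2 ≤ Module.finrank ℚ ↥(maximalRealSubfield L) →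
    ∀ {n' : ℕ} (e₁ : Fin 3 × Fin 1 ≃ Fin n') (dV : Fin 3 → L) (hdV : ∀ i, IsCMField.complexConj L (dV i) = dV i)
      (hdV0 : ∀ i, dV i ≠ 0) (g : GL (Fin 3) L),
      ((g : Matrix (Fin 3) (Fin 3) L).map (cmConjRingHom L))ᵀ * H * (g : Matrix (Fin 3) (Fin 3) L) = Matrix.diagonal dV →
    ∀ (ιA : (adelicGroupData (↥(maximalRealSubfield L)) L (IsCMField.complexConj L) 3 H).Adelic →*
        ↥(UnitaryGroup.adelic (↥(maximalRealSubfield L)) L (IsCMField.complexConj L) 3 (Matrix.diagonal dV))),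
      (∀ k, ((ιA k : ↥(UnitaryGroup.adelic (↥(maximalRealSubfield L)) L (IsCMField.complexConj L) 3 (Matrix.diagonal dV))) :
            GL (Fin 3) (AdeleRing (𝓞 L) L)) =
          (toAdeleGL L g)⁻¹ * adelicVal (↥(maximalRealSubfield L)) L (IsCMField.complexConj L) 3 H k * toAdeleGL L g) →
    ∀ [CompactSpace (↥(UnitaryGroup.adelic (↥(maximalRealSubfield L)) L (IsCMField.complexConj L) 3 (Matrix.diagonal dV)) ⧸
        (UnitaryGroup.toAdelic (↥(maximalRealSubfield L)) L (IsCMField.complexConj L) 3 (Matrix.diagonal dV)).range)],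
    ∀ (μA : Measure (adelicGroupData (↥(maximalRealSubfield L)) L (IsCMField.complexConj L) 3 H).automorphicQuotient)
      [(adelicGroupData (↥(maximalRealSubfield L)) L (IsCMField.complexConj L) 3 H).IsAutomorphicMeasure μA],
      ∀ (P : DiscreteAutomorphicRep (adelicGroupData (↥(maximalRealSubfield L)) L (IsCMField.complexConj L) 3 H) μA)
        (μ : Literature.NumberTheory.Automorphic.IdeleClassGroup L →ₜ* Circle) (hμ : IsConjugateSymplectic L μ)
        (a : (↥(maximalRealSubfield L))ˣ),
        MeetsThetaLiftFromLine L 3 H e₁ dV hdV hdV0 P μ hμ a ιA →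
        P.IsHolCotangentAt (cmArchSection L ι H T hT) (cmCompactFactor L ι H T hT) →
          HasWeight L μ 1 ∧
            IsAdmissibleElement L hμ.cmType.1 (algebraMap (↥(maximalRealSubfield L)) L a * (2 * imagUnit L)⁻¹)

end Literature.NumberTheory.Automorphic.Liu2021

end
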